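import Literature.Claims.NS.Ruzmaikina2008
import Literature.Analysis.FluidPDE.TaoClassGlobal
import Literature.Analysis.FluidPDE.ClassicalSolutionGlue
import Literature.Analysis.FluidPDE.RapidDecayLemmas
import HarnessLib

/-!
# Solo salvage for claim C25 `Ruzmaikina2008` (cell `ns-claims`, D-0090): the logarithmic
# differential inequality (48) (Step 3) is TRUE — kernel discharge at the scalar grain

Claim skeleton: `Literature/Claims/NS/Ruzmaikina2008.lean` (typist `ns-claims-typist-2`; A. A. Ruzmaikina,
arXiv:0810.0318 v2, «On boundedness, existence and uniqueness of strong solutions of the Navier–Stokes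
equations in 3 dimensions»). Kill of record: `…Theorems.Ruzmaikina2008.not_Inference50` (Step 5, the
inference (49) ⇒ (50) p. 21; `SoloRefuteRuzmaikina2008.lean`). This file (seat `ns-claims-salvage-p3`)
kernel-discharges the TRUE scalar step that precedes the locator:

* `ruzmaikina2008_ineq48_holds : Ineq48` — Step 3, p. 19–20 up to (48): if `X ≥ (e^e)ⁿ` on `[a,b]`,
  `X' ≤ n X K` (one-sided derivatives within `[a,b]`) and `K < ln n`, `n ≥ 2`, then
  `(ln ln ln X)' ≤ 1` within `[a,b]`. Proof: chain rule,
  `(ln ln ln X)' = X'/(X · ln X · ln ln X) ≤ nK/(ln X · ln ln X)`, and `ln X ≥ n e ≥ n`,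
  `ln ln X ≥ 1 + ln n > ln n > K`. Elementary real calculus (no source beyond the claim's own display;
  Mathlib `HasDerivWithinAt.log`).

With the skeleton's `ineq49_holds` (Step 4) and `root51_holds` (Step 6) this closes the kernel status
of every SCALAR step of the Part-1 chain except the locator Step 5.

* (rev 2) `ruzmaikina2008_clayDelta_holds : ClayDelta` — the skeleton's Clay-link delta Δ6 («unique
  solutions on the nested horizons `[0,T]` patch to ONE global solution in the class») is TRUE: pure
  bookkeeping over the tree (`IsClassicalNSSolutionOn.of_forall_Ico_nat`, exhaustion of `[0,∞)` by
  `[0,N+1)`; `….pressure_sub_apply_zero_eq_of_eventuallyEq`, pressures with the same velocity differ by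
  a function of time, so the pressures normalised by `p(t,0) = 0` patch). Consequence: the skeleton's
  `clay_of_claimed_of_delta ruzmaikina2008_clayDelta_holds : ClaimedTheorem → clayR3.Regularity` is
  unconditional — C25 (and C30, whose `ClayDelta30` is the same statement on a smaller data class) have
  NO residual delta against Clay (A) in the kernel.

Solo lane (`Theorems/SoloSalvage<Slug>.lean`, no item).

WHAT THIS IS NOT: not a claim about NS regularity or blow-up; not a claim about any author beyond the
typed locator.
-/

noncomputable section

-- The summit-side namespace repeats the summit name by design (D-0017 layout); tree precedent
-- `SoloSalvageLam2019.lean`.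
set_option linter.dupNamespace false

open Set

namespace Summit.NavierStokesRegularity.NavierStokesRegularity.Theorems.Ruzmaikina2008Salvage

open Literature.Claims.NS.Ruzmaikina2008

/-- **Step 3 — (48) p. 20 holds (scalar grain):** for `n ≥ 2`, `X ≥ (e^e)ⁿ` on `[a,b]` with
`X' ≤ n X K` within `[a,b]` and `K < ln n`, the triple logarithm `ln ln ln X` has one-sided derivative
`X'/(X ln X ln ln X) ≤ 1` within `[a,b]`. -/
theorem ruzmaikina2008_ineq48_holds : Literature.Claims.NS.Ruzmaikina2008.Ineq48 := by
  intro n a b X K hn _hab hX hD hK t ht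
  obtain ⟨D, hDX, hDle⟩ := hD t ht
  have hn2 : (2 : ℝ) ≤ n := by exact_mod_cast hn
  have hee : (0 : ℝ) < Real.exp (Real.exp 1) ^ n := by positivity
  have hXpos : 0 < X t := lt_of_lt_of_le hee (hX t ht)
  have he1 : 1 ≤ Real.exp 1 := Real.one_le_exp (by norm_num)
  -- `ln X ≥ n e`
  have hlogX : (n : ℝ) * Real.exp 1 ≤ Real.log (X t) := by
    have h := Real.log_le_log hee (hX t ht)
    rwa [Real.log_pow, Real.log_exp] at h
  have hlogX_ge_n : (n : ℝ) ≤ Real.log (X t) := by nlinarith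
  have hlogX_pos : 0 < Real.log (X t) := by linarith
  -- `ln ln X ≥ ln n + 1`
  have hlogn : 0 < Real.log n := Real.log_pos (by linarith)
  have hloglog : Real.log n + 1 ≤ Real.log (Real.log (X t)) := by
    have h1 : Real.log ((n : ℝ) * Real.exp 1) ≤ Real.log (Real.log (X t)) :=
      Real.log_le_log (by positivity) hlogX
    rwa [Real.log_mul (by positivity) (by positivity), Real.log_exp] at h1
  have hloglog_pos : 0 < Real.log (Real.log (X t)) := by linarith
  -- chain rule for `ln ln ln X`
  have h1 : HasDerivWithinAt (fun s => Real.log (X s)) (D / X t) (Icc a b) t := hDX.log hXpos.ne'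
  have h2 : HasDerivWithinAt (fun s => Real.log (Real.log (X s))) (D / X t / Real.log (X t))
      (Icc a b) t := h1.log hlogX_pos.ne'
  have h3 : HasDerivWithinAt (fun s => lll (X s))
      (D / X t / Real.log (X t) / Real.log (Real.log (X t))) (Icc a b) t := by
    have h := h2.log hloglog_pos.ne'
    simpa only [lll] using h
  refine ⟨_, h3, ?_⟩
  -- the bound `X'/(X ln X ln ln X) ≤ 1`
  rw [div_div, div_div]
  have hden : 0 < X t * (Real.log (X t) * Real.log (Real.log (X t))) := by positivity
  rw [div_le_one hden]
  have hK' : K t ≤ Real.log n := (hK t ht).le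
  have hnum : D ≤ (n : ℝ) * X t * Real.log n :=
    hDle.trans (mul_le_mul_of_nonneg_left hK' (by positivity))
  have hprod : (n : ℝ) * Real.log n ≤ Real.log (X t) * Real.log (Real.log (X t)) :=
    mul_le_mul hlogX_ge_n (by linarith) hlogn.le hlogX_pos.le
  calc D ≤ (n : ℝ) * X t * Real.log n := hnum
    _ = X t * ((n : ℝ) * Real.log n) := by ring
    _ ≤ X t * (Real.log (X t) * Real.log (Real.log (X t))) :=
        mul_le_mul_of_nonneg_left hprod hXpos.le

/-! ### rev 2: the horizon-patching delta `ClayDelta` is a theorem -/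

open Filter Topology Literature.Analysis.FluidPDE

/-- Restriction of a solution on `[0,T]` to a shorter horizon `[0,T']`, `0 < T' ≤ T` (plumbing). -/
theorem isSolution_of_le {ν T T' : ℝ} {u₀ : EuclideanSpace ℝ (Fin 3) → EuclideanSpace ℝ (Fin 3)}
    {u : ℝ → EuclideanSpace ℝ (Fin 3) → EuclideanSpace ℝ (Fin 3)} {p : ℝ → EuclideanSpace ℝ (Fin 3) → ℝ}
    (h : IsSolution ν T u₀ u p) (hT' : 0 < T') (hle : T' ≤ T) : IsSolution ν T' u₀ u p :=
  ⟨⟨h.sol.isClassical.mono (Icc_subset_Icc_right hle) (uniqueDiffOn_Icc hT'),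
    h.sol.sobolev.mono (Icc_subset_Icc_right hle)⟩, h.initial⟩

/-- Subtracting the value at the spatial origin from the pressure keeps a classical solution classical
(the momentum equation only sees `∇p`; joint smoothness by `IsSmoothSpaceTimeOn.sub_apply_zero`). -/
theorem isClassicalNSSolutionOn_sub_apply_zero {S : Set ℝ} {ν : ℝ}
    {u : ℝ → EuclideanSpace ℝ (Fin 3) → EuclideanSpace ℝ (Fin 3)} {p : ℝ → EuclideanSpace ℝ (Fin 3) → ℝ}
    (h : IsClassicalNSSolutionOn S ν 0 u p) :
    IsClassicalNSSolutionOn S ν 0 u (fun t x => p t x - p t 0) where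
  smooth_velocity := h.smooth_velocity
  smooth_pressure := h.smooth_pressure.sub_apply_zero
  momentum t ht x := by
    rw [gradient_sub_const]
    exact h.momentum t ht x
  divFree := h.divFree

/-- **`ClayDelta` holds** (axis Δ6, horizon bookkeeping): if for a datum solutions in the class exist on
every `[0,T]` and are unique there, ONE global solution in the class exists. Construction: pick
`(Uₙ, Pₙ)` on `[0, n+1]`; by uniqueness the velocities agree on common horizons, so `u(t) := U_{⌊t⌋}(t)`
equals `U_N` on `[0, N+1)`; the pressures, normalised by their value at `x = 0`, agree at interior times
(`pressure_sub_apply_zero_eq_of_eventuallyEq`) and at `t = 0` by continuity; the patched pair is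
classical on every `[0,N+1)` (`congr_slices`), hence on `[0,∞)` (`of_forall_Ico_nat`), with all Sobolev
norms bounded on every `[0,T]`. -/
theorem ruzmaikina2008_clayDelta_holds : Literature.Claims.NS.Ruzmaikina2008.ClayDelta := by
  intro ν _hν u₀ _hu₀ hex huniq
  -- solutions on the horizons `[0, n+1]`
  have hsol : ∀ n : ℕ, ∃ (u : ℝ → EuclideanSpace ℝ (Fin 3) → EuclideanSpace ℝ (Fin 3))
      (p : ℝ → EuclideanSpace ℝ (Fin 3) → ℝ), IsSolution ν ((n : ℝ) + 1) u₀ u p :=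
    fun n => hex _ (by positivity)
  choose U P hUP using hsol
  -- velocities agree on common horizons
  have hcons : ∀ (n m : ℕ) (t : ℝ), 0 ≤ t → t ≤ (n : ℝ) + 1 → t ≤ (m : ℝ) + 1 → U n t = U m t := by
    intro n m t ht0 htn htm
    have hT'pos : 0 < min ((n : ℝ) + 1) ((m : ℝ) + 1) := lt_min (by positivity) (by positivity)
    have h1 : IsSolution ν (min ((n : ℝ) + 1) ((m : ℝ) + 1)) u₀ (U n) (P n) :=
      isSolution_of_le (hUP n) hT'pos (min_le_left _ _)
    have h2 : IsSolution ν (min ((n : ℝ) + 1) ((m : ℝ) + 1)) u₀ (U m) (P m) :=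
      isSolution_of_le (hUP m) hT'pos (min_le_right _ _)
    exact huniq _ hT'pos (U m) (P m) (U n) (P n) h2 h1 t ⟨ht0, le_min htn htm⟩
  -- normalised pressures agree at interior times …
  have hpcons : ∀ (n m : ℕ) (t : ℝ), 0 < t → t < (n : ℝ) + 1 → t < (m : ℝ) + 1 →
      ∀ x, P n t x - P n t 0 = P m t x - P m t 0 := by
    intro n m t ht0 htn htm x
    refine (hUP n).sol.isClassical.pressure_sub_apply_zero_eq_of_eventuallyEq (hUP m).sol.isClassical
      (Icc_mem_nhds ht0 htn) (Icc_mem_nhds ht0 htm) ?_ x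
    have hnhds : ∀ᶠ τ in 𝓝 t, τ ∈ Ioo 0 (min ((n : ℝ) + 1) ((m : ℝ) + 1)) :=
      Ioo_mem_nhds ht0 (lt_min htn htm)
    exact hnhds.mono fun τ hτ => hcons n m τ hτ.1.le (hτ.2.trans_le (min_le_left _ _)).le
      (hτ.2.trans_le (min_le_right _ _)).le
  -- … and at `t = 0` by continuity from the right
  have hpcons0 : ∀ (n m : ℕ) (x : EuclideanSpace ℝ (Fin 3)), P n 0 x - P n 0 0 = P m 0 x - P m 0 0 := by
    intro n m x
    have hc : ∀ k : ℕ, Filter.Tendsto (fun τ => P k τ x - P k τ 0) (𝓝[Ioo 0 1] 0)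
        (𝓝 (P k 0 x - P k 0 0)) := by
      intro k
      have hsm := (hUP k).sol.isClassical.smooth_pressure.sub_apply_zero
      have hcw := hsm.continuousWithinAt_time (t := 0) ⟨le_rfl, by positivity⟩ x
      refine (hcw.tendsto.mono_left (nhdsWithin_mono _ fun τ hτ => ?_))
      exact ⟨hτ.1.le, hτ.2.le.trans (by norm_cast; simp)⟩
    have heq : ∀ᶠ τ in 𝓝[Ioo (0 : ℝ) 1] 0, P n τ x - P n τ 0 = P m τ x - P m τ 0 := by
      filter_upwards [self_mem_nhdsWithin] with τ hτ
      exact hpcons n m τ hτ.1 (hτ.2.trans_le (by norm_cast; simp)) (hτ.2.trans_le (by norm_cast; simp)) x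
    haveI : (𝓝[Ioo (0 : ℝ) 1] 0).NeBot := by
      apply mem_closure_iff_nhdsWithin_neBot.mp
      rw [closure_Ioo zero_ne_one]
      exact ⟨le_rfl, zero_le_one⟩
    exact tendsto_nhds_unique_of_eventuallyEq (hc n) (hc m) heq
  -- the patched fields
  set u : ℝ → EuclideanSpace ℝ (Fin 3) → EuclideanSpace ℝ (Fin 3) := fun t => U ⌊t⌋₊ t with hu
  set q : ℝ → EuclideanSpace ℝ (Fin 3) → ℝ := fun t x => P ⌊t⌋₊ t x - P ⌊t⌋₊ t 0 with hq
  -- on `[0, N+1)` they are `(U N, P N − P N(·,0))`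
  have hagree_u : ∀ (N : ℕ), ∀ t ∈ Ico 0 ((N : ℝ) + 1), u t = U N t := fun N t ht =>
    hcons ⌊t⌋₊ N t ht.1 (Nat.lt_floor_add_one t).le ht.2.le
  have hagree_q : ∀ (N : ℕ), ∀ t ∈ Ico 0 ((N : ℝ) + 1), q t = fun x => P N t x - P N t 0 := by
    intro N t ht
    funext x
    rcases ht.1.eq_or_lt with h0 | h0
    · rw [← h0]
      show P ⌊(0 : ℝ)⌋₊ 0 x - P ⌊(0 : ℝ)⌋₊ 0 0 = P N 0 x - P N 0 0
      rw [Nat.floor_zero]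
      exact hpcons0 0 N x
    · exact hpcons ⌊t⌋₊ N t h0 (Nat.lt_floor_add_one t) ht.2 x
  have hslab : ∀ N : ℕ, IsClassicalNSSolutionOn (Ico 0 ((N : ℝ) + 1)) ν 0 u q := by
    intro N
    have hN : IsClassicalNSSolutionOn (Ico 0 ((N : ℝ) + 1)) ν 0 (U N) (fun t x => P N t x - P N t 0) :=
      (isClassicalNSSolutionOn_sub_apply_zero (hUP N).sol.isClassical).mono Ico_subset_Icc_self
        (uniqueDiffOn_Ico 0 _)
    exact hN.congr_slices (hagree_u N) (hagree_q N)
  refine ⟨u, q, ⟨IsClassicalNSSolutionOn.of_forall_Ico_nat hslab, ?_, fun T => ?_⟩⟩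
  · show U ⌊(0 : ℝ)⌋₊ 0 = u₀
    rw [Nat.floor_zero]
    exact (hUP 0).initial
  · -- Sobolev bounds on `[0,T]`: there `u = U N` with `N = ⌈max T 0⌉₊`
    set N : ℕ := ⌈max T 0⌉₊ with hN
    have hTN : T < (N : ℝ) + 1 :=
      (le_max_left T 0).trans_lt ((Nat.le_ceil (max T 0)).trans_lt (lt_add_one _))
    intro n
    obtain ⟨C, hC⟩ := (hUP N).sol.sobolev n
    refine ⟨C, fun t ht => ?_⟩
    have htI : t ∈ Ico 0 ((N : ℝ) + 1) := ⟨ht.1, ht.2.trans_lt hTN⟩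
    rw [hagree_u N t htI]
    exact hC t ⟨ht.1, htI.2.le⟩

end Summit.NavierStokesRegularity.NavierStokesRegularity.Theorems.Ruzmaikina2008Salvage

end
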